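import Summits.ABC.IUTFork.Conditional.AbcOfSGenuineKChosenDepthRadRatPoint
import Summits.ABC.IUTFork.Cor312GenuineKLocalType
import Literature.IUT.LogVolume.GenuineTowerLocalTypeTate
import Literature.Barriers.ABC.ExplicitABCQualityFloor
import HarnessLib

/-!
# R-W table rows DECIDED on the refuted side by the EXACT-RADIUS («RAD») engine at a WILD place — UNCONDITIONALLY:
# part 1: the Reyssat triple `2 + 3¹⁰·109 = 23⁵` at `p = 23` (`e ≥ 13 > p − 2`: no tame decider applies) for `l = 13, 17, 19`

PROOF-ONLY file (no `def`, no new `Prop`, no instance) of the abc-iut cell (WAVE-5 prover seat abc-iut-w5-d236, gen 9; D-0079 R-W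
«WINDOW Θ-SIDE INEQUALITY», CLAIM «W:RAD-GENUINEK lane=P−»; sequel of this seat's `AbcOfSGenuineKChosenDepthRadRatPoint` p464754, whose
`GenuineK.not_pilotKummerCompatHull_chosen_ratPoint_of_star_envelope_of_not_dvd` is instantiated once per (row, local type)). TAKES NO SIDE on
[IUTchIII] Cor. 3.12 or on any author. The rows are the R-W numerics lead's CRITICAL-PATH Reyssat rows (HOME/plan/rescue/R-W/README F2-3,
HOME/STATUS 2026-08-26T17:16:32Z: «Reyssat 2+3¹⁰109 = 23⁵ @ 13/17/19 is DATUM-REFUTED since the v3.4 merge — abc-iut-W-num-6's [RAD] (p454852+p454022)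
fires at p = 23 for both local types (−146/39, −131/78) while [LIN]/[ED] leave it open»); until this file they were numerics only.

INPUTS, BY NAME. (a) The Frey–Legendre dictionary, exact form (abc-iut-W-neg-1 / abc-iut-W-ref-2 `Cor22.ord_jInv_ratPoint_triple_eq`):
`ord_23 j(2/23⁵) = −2·v_23(2·3¹⁰·109·23⁵) = −10`. (b) The TATE-EXACT local type (abc-iut-W-ref-2 `SubThetaFieldRamificationTateUnramified` +
abc-iut-W-neg-1 `GenuineTowerLocalTypeTate`, `ThetaVolumeDatumAt.ramificationIdx_int_dvd_six_mul_ratPoint'`): since `5 ∣ ord_23 j`, EVERY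
place `x₀ | 23` of the `l`-division field `T.K` of a genuine Θ-volume datum at `(ratPoint (2/23⁵), l)` has `e(K_{x₀}/ℚ_23) ∣ 6·l` —
§0 restates this at the FIBRE POINTS of `pilotDataOfK T.D T.K` (the plumbing of abc-iut-W-neg-1's `GenuineK.absRamificationIdx_kOf_dvd_ratPoint`,
verbatim, with `6` for `60`; also the `3 ∣ ord ⇒ ∣ 10·l` twin for later rows). (c) The RAD certificate of p464754 at `p = 23`, `h = 10`, top
label `j = l⋆`, for EVERY divisor `e` of `6·l` — integers `(A, a₀, N)` per `e` found at the desk (HOME/…/w5-d236 work/radcert.py) and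
re-checked here by `norm_num`: `l = 13`: `e ∈ {1,2,3,6,13,26,39,78}`, `N = 6` (`e = 1`) / `7`; `l = 17`: `e ∣ 102`, `N = 9/10`;
`l = 19`: `e ∣ 114`, `N = 11/12`. (So NO residual local-type binder: the rows are unconditional theorems about every genuine datum.)

* §0 `GenuineK.absRamificationIdx_kOf_dvd_six_mul_ratPoint` / `…_ten_mul_…` — fibre-point Tate-exact local types.
* §1 `Reyssat.ord_jInv_twentyThree` — the datum's integers (the triple itself is the tree's `Literature.Barriers.ABC.reyssat_isABCTriple`).
* §2 `GenuineK.not_pilotKummerCompatHull_chosen_reyssat_thirteen` / `_seventeen` / `_nineteen` — at EVERY genuine Θ-volume datum `T` over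
  `(ratPoint (2/23⁵), l)`, `l = 13, 17, 19`, the hull-level clause S_H (chosen realising ideles, pinned reading — the per-datum object of the
  window binders `hSHw`/`hSHwBad` p447945/p450130/p453137) FAILS for every choice of the free context binders and Kummer datum; the refuting
  packet is `(j = l⋆, any x₀ | 23)`, a WILD place (`e ≥ l > 21 = p − 2` at the realised types) — the first genuine-datum kernel decision of the
  R-W table in stratum U2 by an engine other than [LIN].
NOT claimed: admissibility (UP / AdmitsCore / CondP2 / CondP5 / CondP6) and Szpiro-badness of `(ratPoint (2/23⁵), l)` (the guard of the records
— abc-iut-c312-d1's «HEX-SZPIRO-KERNEL» row (A), margin −0.333 at `l = 13`) and non-emptiness of the datum type: the apex «¬ hSHwBad» assemblers'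
inputs. HONEST SCOPE as in the parents: an UPPER BOUND on the hull read at ONE diagonal summand; SHARP reading; per-label licence STRONGER than
print; «refuted as typed» ≠ «refuted in print»; nothing about the number-level Corollary; typed ≠ proved; instantiated ≠ endorsed.
[cite: Mochizuki2012, IUTchIII Cor. 3.12 Step (xi-f) p. 184; IUTchIV Prop. 1.2 (i)(ii) p. 10, Cor. 2.2 (ii) proof p. 44–46, Thm. 1.10 Steps (ii)–(iii) p. 24–26]
[cite: Serre1972, §1.11–§1.12] [cite: NeukirchANT1999, Ch. II (5.5)] [cite: Oesterle1988, §1] [claim: Mochizuki2012, status: disputed] for every IUT sentence quoted.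
-/

noncomputable section

open Set Function NumberField IsDedekindDomain

namespace Summit.ABC.IUTFork.Conditional

open Thm311 Thm311.Real Cor312 Cor312Vol Cor312Prov Literature.IUT.LogThetaLattice Literature.IUT.LogVolume
  Literature.IUT.HodgeTheaters Literature.IUT.LogVolume.ThetaData Literature.IUT.LogVolume.Cor22
open Literature.NumberTheory.NumberFields Literature.NumberTheory.GaloisRepresentations.Ultrametric
open Literature.NumberTheory.DiophantineGeometry Literature.NumberTheory.DiophantineGeometry.GenEll Summit.ABC.ABC.Theorems

/-! ## §0. Tate-exact local types at the fibre points of the genuine `K`-datum -/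

/-- **`5 ∣ ord_p j(λ) ⇒ e(K_{x₀}/ℚ_p) ∣ 6·l` at every fibre point `x₀ | p`** (`p ∉ {2, 3, 5, l}` a pole of `j(λ)`, `λ ∈ ℚ`, `T` a genuine
Θ-volume datum at `(ratPoint λ, l)`): the Tate-exact local type of abc-iut-W-ref-2 / abc-iut-W-neg-1
(`ThetaVolumeDatumAt.ramificationIdx_int_dvd_six_mul_ratPoint'`: the `5`-torsion is unramified when `5 ∣ ord_v(q)`, Serre 1972 §1.11–1.12)
read at the norm-defined ramification index of the completion carrying `x₀` (plumbing verbatim from `GenuineK.absRamificationIdx_kOf_dvd_ratPoint`).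
[cite: Mochizuki2012, IUTchIV Thm. 1.10 proof Steps (ii)–(iii) p. 24–26] [cite: Serre1972, §1.11–§1.12] [claim: Mochizuki2012, status: disputed] -/
theorem GenuineK.absRamificationIdx_kOf_dvd_six_mul_ratPoint {q : ℚ} {l : ℕ} (T : Cor22.ThetaVolumeDatumAt (ratPoint q) l)
    (pp : Nat.Primes) (hp2 : (pp : ℕ) ≠ 2) (hp3 : (pp : ℕ) ≠ 3) (hp5 : (pp : ℕ) ≠ 5) (hpl : (pp : ℕ) ≠ l)
    (hpole : ∀ v : HeightOneSpectrum (𝓞 ℚ), Rat.HeightOneSpectrum.natGenerator v = pp →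
      Literature.IUT.LogVolume.ord ℚ v (Cor22.jInv q) < 0)
    (hord : ∀ v : HeightOneSpectrum (𝓞 ℚ), Rat.HeightOneSpectrum.natGenerator v = pp →
      (5 : ℤ) ∣ Literature.IUT.LogVolume.ord ℚ v (Cor22.jInv q)) :
    letI := T.instFieldF; letI := T.instNumberFieldF; letI := T.instAlgebraF; letI := T.instFieldK
    letI := T.instNumberFieldK; letI := T.instAlgebraK; letI := T.instFieldFbar; letI := T.instAlgebraFbar
    letI := T.instAlgebraKFbar; letI := T.instIsElliptic
    haveI : Fact (pp : ℕ).Prime := ⟨pp.2⟩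
    ∀ x₀ : (thetaIndex (pilotDataOfK T.D T.K)).Fibre (.inr pp),
      absRamificationIdx (pp : ℕ) (kOf (pilotDataOfK T.D T.K) pp.1 x₀) ∣ 6 * l := by
  letI := T.instFieldF; letI := T.instNumberFieldF; letI := T.instAlgebraF; letI := T.instFieldK
  letI := T.instNumberFieldK; letI := T.instAlgebraK; letI := T.instFieldFbar; letI := T.instAlgebraFbar
  letI := T.instAlgebraKFbar; letI := T.instIsElliptic
  haveI : Fact (pp : ℕ).Prime := ⟨pp.2⟩
  set X := pilotDataOfK T.D T.K with hXdef
  intro x₀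
  set w := placeOf X pp.1 x₀ with hwdef
  have hpw : ((pp : ℕ) : 𝓞 T.K) ∈ w.asIdeal := natCast_mem_placeOf X pp.1 x₀
  have hwchar : residueChar T.K w = (pp : ℕ) := residueChar_eq_of_natCast_mem pp.1 hpw
  have hekOf : absRamificationIdx (pp : ℕ) (kOf X pp.1 x₀) = w.asIdeal.ramificationIdx ℤ := by
    rw [show absRamificationIdx (pp : ℕ) (kOf X pp.1 x₀) =
        absRamificationIdx (pp : ℕ) (RescaledCompletion T.K pp.1 (placeOf X pp.1 x₀) hpw) from rfl,
      absRamificationIdx_rescaledCompletion]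
  have hnot : (pp : ℕ) ∉ ({2, 3, 5, l} : Finset ℕ) := by
    simp only [Finset.mem_insert, Finset.mem_singleton, not_or]
    exact ⟨hp2, hp3, hp5, hpl⟩
  rw [hekOf]
  exact T.ramificationIdx_int_dvd_six_mul_ratPoint' hnot hpole hord w hwchar

/-- **`3 ∣ ord_p j(λ) ⇒ e(K_{x₀}/ℚ_p) ∣ 10·l` at every fibre point `x₀ | p`** (same setting; the `3`-torsion is unramified when
`3 ∣ ord_v(q)`; `ThetaVolumeDatumAt.ramificationIdx_int_dvd_ten_mul_ratPoint'`). [cite: Mochizuki2012, IUTchIV Thm. 1.10 proof Steps (ii)–(iii) p. 24–26]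
[cite: Serre1972, §1.11–§1.12] [claim: Mochizuki2012, status: disputed] -/
theorem GenuineK.absRamificationIdx_kOf_dvd_ten_mul_ratPoint {q : ℚ} {l : ℕ} (T : Cor22.ThetaVolumeDatumAt (ratPoint q) l)
    (pp : Nat.Primes) (hp2 : (pp : ℕ) ≠ 2) (hp3 : (pp : ℕ) ≠ 3) (hp5 : (pp : ℕ) ≠ 5) (hpl : (pp : ℕ) ≠ l)
    (hpole : ∀ v : HeightOneSpectrum (𝓞 ℚ), Rat.HeightOneSpectrum.natGenerator v = pp →
      Literature.IUT.LogVolume.ord ℚ v (Cor22.jInv q) < 0)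
    (hord : ∀ v : HeightOneSpectrum (𝓞 ℚ), Rat.HeightOneSpectrum.natGenerator v = pp →
      (3 : ℤ) ∣ Literature.IUT.LogVolume.ord ℚ v (Cor22.jInv q)) :
    letI := T.instFieldF; letI := T.instNumberFieldF; letI := T.instAlgebraF; letI := T.instFieldK
    letI := T.instNumberFieldK; letI := T.instAlgebraK; letI := T.instFieldFbar; letI := T.instAlgebraFbar
    letI := T.instAlgebraKFbar; letI := T.instIsElliptic
    haveI : Fact (pp : ℕ).Prime := ⟨pp.2⟩
    ∀ x₀ : (thetaIndex (pilotDataOfK T.D T.K)).Fibre (.inr pp),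
      absRamificationIdx (pp : ℕ) (kOf (pilotDataOfK T.D T.K) pp.1 x₀) ∣ 10 * l := by
  letI := T.instFieldF; letI := T.instNumberFieldF; letI := T.instAlgebraF; letI := T.instFieldK
  letI := T.instNumberFieldK; letI := T.instAlgebraK; letI := T.instFieldFbar; letI := T.instAlgebraFbar
  letI := T.instAlgebraKFbar; letI := T.instIsElliptic
  haveI : Fact (pp : ℕ).Prime := ⟨pp.2⟩
  set X := pilotDataOfK T.D T.K with hXdef
  intro x₀
  set w := placeOf X pp.1 x₀ with hwdef
  have hpw : ((pp : ℕ) : 𝓞 T.K) ∈ w.asIdeal := natCast_mem_placeOf X pp.1 x₀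
  have hwchar : residueChar T.K w = (pp : ℕ) := residueChar_eq_of_natCast_mem pp.1 hpw
  have hekOf : absRamificationIdx (pp : ℕ) (kOf X pp.1 x₀) = w.asIdeal.ramificationIdx ℤ := by
    rw [show absRamificationIdx (pp : ℕ) (kOf X pp.1 x₀) =
        absRamificationIdx (pp : ℕ) (RescaledCompletion T.K pp.1 (placeOf X pp.1 x₀) hpw) from rfl,
      absRamificationIdx_rescaledCompletion]
  have hnot : (pp : ℕ) ∉ ({2, 3, 5, l} : Finset ℕ) := by
    simp only [Finset.mem_insert, Finset.mem_singleton, not_or]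
    exact ⟨hp2, hp3, hp5, hpl⟩
  rw [hekOf]
  exact T.ramificationIdx_int_dvd_ten_mul_ratPoint' hnot hpole hord w hwchar

/-! ## §1. The Reyssat triple `2 + 3¹⁰·109 = 23⁵`: the integers of the datum `λ = 2/23⁵` at `p = 23` -/

/-- **`ord_23 j(2/23⁵) = −10` EXACTLY** (`j(a/c) = 2⁸(a² − ac + c²)³/(abc)²`, `v_23(2·3¹⁰·109·23⁵) = 5`; abc-iut-W-neg-1's
`Cor22.ord_jInv_ratPoint_triple_eq`). [cite: Mochizuki2012, IUTchIV Cor. 2.2 (ii) proof p. 44] [cite: SilvermanAEC2009, Prop. III.1.7(b)] -/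
theorem Reyssat.ord_jInv_twentyThree (u : HeightOneSpectrum (𝓞 ℚ)) (hu : Rat.HeightOneSpectrum.natGenerator u = 23) :
    Literature.IUT.LogVolume.ord ℚ u (Cor22.jInv (((2 : ℕ) : ℚ) / ((23 ^ 5 : ℕ) : ℚ))) = -((10 : ℕ) : ℤ) := by
  have habc := Literature.Barriers.ABC.reyssat_isABCTriple
  have h0 : 2 * (3 ^ 10 * 109) * 23 ^ 5 ≠ 0 := by norm_num
  have hp : Nat.Prime 23 := by norm_num
  have hfac : (2 * (3 ^ 10 * 109) * 23 ^ 5).factorization 23 = 5 := by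
    have h1 : 5 ≤ (2 * (3 ^ 10 * 109) * 23 ^ 5).factorization 23 :=
      (hp.pow_dvd_iff_le_factorization h0).1 (dvd_mul_left _ _)
    have h2 : ¬ 6 ≤ (2 * (3 ^ 10 * 109) * 23 ^ 5).factorization 23 := fun h6 =>
      absurd ((hp.pow_dvd_iff_le_factorization h0).2 h6) (by norm_num)
    omega
  rw [Cor22.ord_jInv_ratPoint_triple_eq habc u (by rw [hu]; norm_num) (by rw [hu]; norm_num), hu, hfac]
  norm_num

/-! ## §2. The Reyssat rows at `p = 23`: `l = 13, 17, 19` -/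

/-- **R-W ROW `pilotDataOfK:frey-2-6436341-6436343:13` (Reyssat, `l = 13`) — REFUTED side, UNCONDITIONALLY, at the WILD place `p = 23`.**
At every genuine Θ-volume datum `T` over `(ratPoint (2/23⁵), 13)` the hull-level clause S_H (chosen realising ideles, pinned reading) FAILS
for every choice of the free context binders and Kummer datum: at any `x₀ | 23` the local type `e = e(K_{x₀}/ℚ_23)` divides `6·13`
(Tate-exact, `5 ∣ ord_23 j = −10`), and for EACH such `e` the RAD certificate at the top label `j = 6` holds (`h = 10`, `δ = e − 1`;
`(A, a₀, N) = (1,0,6), (1,0,7), (1,0,7), (1,0,7), (1,0,7), (2,1,7), (2,1,7), (4,1,7)` for `e = 1, 2, 3, 6, 13, 26, 39, 78`).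
[cite: Mochizuki2012, IUTchIII Cor. 3.12 Step (xi-f) p. 184] [claim: Mochizuki2012, status: disputed] -/
theorem GenuineK.not_pilotKummerCompatHull_chosen_reyssat_thirteen
    (T : Cor22.ThetaVolumeDatumAt (ratPoint (((2 : ℕ) : ℚ) / ((23 ^ 5 : ℕ) : ℚ))) 13) :
    letI := T.instFieldF; letI := T.instNumberFieldF; letI := T.instAlgebraF; letI := T.instFieldK
    letI := T.instNumberFieldK; letI := T.instAlgebraK; letI := T.instFieldFbar; letI := T.instAlgebraFbar
    letI := T.instAlgebraKFbar; letI := T.instIsElliptic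
    ∀ (M : Type) [Field M] [NumberField M]
      (archPk : ∀ (j : (thetaIndex (pilotDataOfK T.D T.K)).Label) (vQ : (thetaIndex (pilotDataOfK T.D T.K)).VQ),
        Set ((logShellsDH (pilotDataOfK T.D T.K) (analyticLogv T.K)).Packet j vQ))
      (archSub : ∀ (j : (thetaIndex (pilotDataOfK T.D T.K)).Label) (v : (thetaIndex (pilotDataOfK T.D T.K)).V),
        Set ((logShellsDH (pilotDataOfK T.D T.K) (analyticLogv T.K)).Packet j ((thetaIndex (pilotDataOfK T.D T.K)).over v)))
      (Ψ : ℤ → ∀ v : (thetaIndex (pilotDataOfK T.D T.K)).V, v ∈ (thetaIndex (pilotDataOfK T.D T.K)).Vbad →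
        Set ((logShellsDH (pilotDataOfK T.D T.K) (analyticLogv T.K)).StarPacket v))
      (act : ℤ → ∀ v : (thetaIndex (pilotDataOfK T.D T.K)).V, v ∈ (thetaIndex (pilotDataOfK T.D T.K)).Vbad →
        (logShellsDH (pilotDataOfK T.D T.K) (analyticLogv T.K)).StarPacket v →
          Module.End ℚ ((logShellsDH (pilotDataOfK T.D T.K) (analyticLogv T.K)).StarPacket v))
      (Mmod : ℤ → ∀ j : (thetaIndex (pilotDataOfK T.D T.K)).LabelStar, Set ((logShellsDH (pilotDataOfK T.D T.K) (analyticLogv T.K)).GlobalPacket j.1))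
      (region : ℤ → ∀ j : (thetaIndex (pilotDataOfK T.D T.K)).LabelStar, FinDivisor M → ∀ vQ : (thetaIndex (pilotDataOfK T.D T.K)).VQ,
        Set ((logShellsDH (pilotDataOfK T.D T.K) (analyticLogv T.K)).Packet j.1 vQ))
      (frobAdm : ℤ → ℤ → ∀ (j : (thetaIndex (pilotDataOfK T.D T.K)).Label) (vQ : (thetaIndex (pilotDataOfK T.D T.K)).VQ),
        Set ((logShellsDH (pilotDataOfK T.D T.K) (analyticLogv T.K)).Packet j vQ) → Prop)
      (frobLogvol : ℤ → ℤ → ∀ (j : (thetaIndex (pilotDataOfK T.D T.K)).Label) (vQ : (thetaIndex (pilotDataOfK T.D T.K)).VQ),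
        Set ((logShellsDH (pilotDataOfK T.D T.K) (analyticLogv T.K)).Packet j vQ) → ℝ)
      (frobΨ : ℤ → ℤ → ∀ v : (thetaIndex (pilotDataOfK T.D T.K)).V, v ∈ (thetaIndex (pilotDataOfK T.D T.K)).Vbad →
        Set ((logShellsDH (pilotDataOfK T.D T.K) (analyticLogv T.K)).StarPacket v))
      (frobMmod : ℤ → ℤ → ∀ j : (thetaIndex (pilotDataOfK T.D T.K)).LabelStar, Set ((logShellsDH (pilotDataOfK T.D T.K) (analyticLogv T.K)).GlobalPacket j.1))
      (unitImage : ℤ → ℤ → ℕ → ∀ (j : (thetaIndex (pilotDataOfK T.D T.K)).Label) (vQ : (thetaIndex (pilotDataOfK T.D T.K)).VQ),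
        Set ((logShellsDH (pilotDataOfK T.D T.K) (analyticLogv T.K)).Packet j vQ))
      (ballImage : ℤ → ℤ → ∀ (j : (thetaIndex (pilotDataOfK T.D T.K)).Label) (vQ : (thetaIndex (pilotDataOfK T.D T.K)).VQ),
        Set ((logShellsDH (pilotDataOfK T.D T.K) (analyticLogv T.K)).Packet j vQ))
      (thetaDiv : ℤ → ℤ → LgpDivisor M (thetaIndex (pilotDataOfK T.D T.K)).lstar)
      (n : ℤ) {HT : Type} {LogLink : HT → HT → Type} {IsFull : ∀ {s t : HT}, LogLink s t → Prop}
      (lat : LGPGaussianLogThetaLattice LogLink IsFull)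
      {Frd : Type} {IsoF : Frd → Frd → Type} {Ob : Frd → Type} {realify : Frd → Frd} {Strip : Type}
      {IsoS : Strip → Strip → Type} {Mv : ∀ v : (thetaIndex (pilotDataOfK T.D T.K)).V, v ∈ (thetaIndex (pilotDataOfK T.D T.K)).Vbad → Type}
      [∀ v h, Monoid (Mv v h)]
      (sig : GlobalLGPFrobenioidSignature (thetaIndex (pilotDataOfK T.D T.K)).lstar (thetaIndex (pilotDataOfK T.D T.K)).V
        (· ∈ (thetaIndex (pilotDataOfK T.D T.K)).Vbad) Frd IsoF Ob realify Strip IsoS Mv)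
      (split : SplittingMonoids Mv) {ObΔ : Type} {N : ∀ v : (thetaIndex (pilotDataOfK T.D T.K)).V, v ∈ (thetaIndex (pilotDataOfK T.D T.K)).Vbad → Type}
      [∀ v h, Monoid (N v h)] (qData : QPilotData ObΔ N)
      (qK : ∀ v : (thetaIndex (pilotDataOfK T.D T.K)).V, v ∈ (thetaIndex (pilotDataOfK T.D T.K)).Vbad →
        Set ((logShellsDH (pilotDataOfK T.D T.K) (analyticLogv T.K)).StarPacket v)),
      ¬ Cor312Vol.PilotKummerCompatHull
          (LatticeSituation.ofShells (logShellsDH (pilotDataOfK T.D T.K) (analyticLogv T.K)) M archPk archSub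
            (summandPiecesPr (pilotDataOfK T.D T.K) (logvAnalytic_analyticLogv (F := T.K))).Adm
            (summandPiecesPr (pilotDataOfK T.D T.K) (logvAnalytic_analyticLogv (F := T.K))).logvol Ψ act Mmod region frobAdm frobLogvol frobΨ
            frobMmod unitImage ballImage thetaDiv)
          (settingPrVolSharp (pilotDataOfK T.D T.K) (logvAnalytic_analyticLogv (F := T.K)) M archPk archSub Ψ act Mmod region n lat sig split qData
            (exists_realising_qIdeles_pilotDataOfK T.D).choose (exists_realising_thetaIdeles_pilotDataOfK T.D).choose
            (exists_realising_qIdeles_pilotDataOfK T.D).choose_spec.1 (exists_realising_qIdeles_pilotDataOfK T.D).choose_spec.2.1)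
          (fun _ => Cor312.Setting.qRegion
            (settingPrVolSharp (pilotDataOfK T.D T.K) (logvAnalytic_analyticLogv (F := T.K)) M archPk archSub Ψ act Mmod region n lat sig split qData
              (exists_realising_qIdeles_pilotDataOfK T.D).choose (exists_realising_thetaIdeles_pilotDataOfK T.D).choose
              (exists_realising_qIdeles_pilotDataOfK T.D).choose_spec.1 (exists_realising_qIdeles_pilotDataOfK T.D).choose_spec.2.1)) qK := by
  classical
  letI := T.instFieldF; letI := T.instNumberFieldF; letI := T.instAlgebraF; letI := T.instFieldK
  letI := T.instNumberFieldK; letI := T.instAlgebraK; letI := T.instFieldFbar; letI := T.instAlgebraFbar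
  letI := T.instAlgebraKFbar; letI := T.instIsElliptic
  have hp : Nat.Prime 23 := by norm_num
  haveI : Fact (Nat.Prime 23) := ⟨hp⟩
  intro M _ _ archPk archSub Ψ act Mmod region frobAdm frobLogvol frobΨ frobMmod unitImage ballImage thetaDiv n HT LogLink IsFull lat
    Frd IsoF Ob realify Strip IsoS Mv _ sig split ObΔ N _ qData qK
  obtain ⟨v, hv⟩ := (thetaIndex (pilotDataOfK T.D T.K)).fibre_nonempty (.inr ⟨23, hp⟩)
  have hord : ∀ u : HeightOneSpectrum (𝓞 ℚ), Rat.HeightOneSpectrum.natGenerator u = ((⟨23, hp⟩ : Nat.Primes) : ℕ) →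
      Literature.IUT.LogVolume.ord ℚ u (Cor22.jInv (((2 : ℕ) : ℚ) / ((23 ^ 5 : ℕ) : ℚ))) = -((10 : ℕ) : ℤ) :=
    fun u hu => Reyssat.ord_jInv_twentyThree u hu
  have hpole : ∀ u : HeightOneSpectrum (𝓞 ℚ), Rat.HeightOneSpectrum.natGenerator u = ((⟨23, hp⟩ : Nat.Primes) : ℕ) →
      Literature.IUT.LogVolume.ord ℚ u (Cor22.jInv (((2 : ℕ) : ℚ) / ((23 ^ 5 : ℕ) : ℚ))) < 0 :=
    fun u hu => by rw [hord u hu]; norm_num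
  have hord5 : ∀ u : HeightOneSpectrum (𝓞 ℚ), Rat.HeightOneSpectrum.natGenerator u = ((⟨23, hp⟩ : Nat.Primes) : ℕ) →
      (5 : ℤ) ∣ Literature.IUT.LogVolume.ord ℚ u (Cor22.jInv (((2 : ℕ) : ℚ) / ((23 ^ 5 : ℕ) : ℚ))) :=
    fun u hu => by rw [hord u hu]; norm_num
  have hdvd := GenuineK.absRamificationIdx_kOf_dvd_six_mul_ratPoint T ⟨23, hp⟩ (by norm_num) (by norm_num) (by norm_num) (by norm_num)
    hpole hord5 ⟨v, hv⟩
  -- the eight local types `e ∣ 78`, each with its certificate `(A, a₀, N)`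
  have key : ∀ e : ℕ, absRamificationIdx 23 (kOf (pilotDataOfK T.D T.K) 23 ⟨v, hv⟩) = e → e ∣ 6 * 13 →
      ¬ Cor312Vol.PilotKummerCompatHull
          (LatticeSituation.ofShells (logShellsDH (pilotDataOfK T.D T.K) (analyticLogv T.K)) M archPk archSub
            (summandPiecesPr (pilotDataOfK T.D T.K) (logvAnalytic_analyticLogv (F := T.K))).Adm
            (summandPiecesPr (pilotDataOfK T.D T.K) (logvAnalytic_analyticLogv (F := T.K))).logvol Ψ act Mmod region frobAdm frobLogvol frobΨ
            frobMmod unitImage ballImage thetaDiv)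
          (settingPrVolSharp (pilotDataOfK T.D T.K) (logvAnalytic_analyticLogv (F := T.K)) M archPk archSub Ψ act Mmod region n lat sig split qData
            (exists_realising_qIdeles_pilotDataOfK T.D).choose (exists_realising_thetaIdeles_pilotDataOfK T.D).choose
            (exists_realising_qIdeles_pilotDataOfK T.D).choose_spec.1 (exists_realising_qIdeles_pilotDataOfK T.D).choose_spec.2.1)
          (fun _ => Cor312.Setting.qRegion
            (settingPrVolSharp (pilotDataOfK T.D T.K) (logvAnalytic_analyticLogv (F := T.K)) M archPk archSub Ψ act Mmod region n lat sig split qData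
              (exists_realising_qIdeles_pilotDataOfK T.D).choose (exists_realising_thetaIdeles_pilotDataOfK T.D).choose
              (exists_realising_qIdeles_pilotDataOfK T.D).choose_spec.1 (exists_realising_qIdeles_pilotDataOfK T.D).choose_spec.2.1)) qK := by
    intro e hex he
    have hmem : e ∈ Nat.divisors 78 := Nat.mem_divisors.2 ⟨he, by norm_num⟩
    have h78 : Nat.divisors 78 = {1, 2, 3, 6, 13, 26, 39, 78} := by decide
    rw [h78] at hmem
    simp only [Finset.mem_insert, Finset.mem_singleton] at hmem
    rcases hmem with rfl | rfl | rfl | rfl | rfl | rfl | rfl | rfl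
    · exact GenuineK.not_pilotKummerCompatHull_chosen_ratPoint_of_star_envelope_of_not_dvd T ⟨23, hp⟩ (by norm_num) (by norm_num)
        10 (by norm_num) hord 5 (by norm_num) 1 1 0 6 (by norm_num) (by norm_num) (by norm_num) (by norm_num) (Or.inl rfl)
        (by norm_num) (by norm_num) (by norm_num) ⟨v, hv⟩ hex M archPk archSub Ψ act Mmod region frobAdm frobLogvol frobΨ frobMmod
        unitImage ballImage thetaDiv n lat sig split qData qK
    · exact GenuineK.not_pilotKummerCompatHull_chosen_ratPoint_of_star_envelope_of_not_dvd T ⟨23, hp⟩ (by norm_num) (by norm_num)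
        10 (by norm_num) hord 5 (by norm_num) 2 1 0 7 (by norm_num) (by norm_num) (by norm_num) (by norm_num) (Or.inl rfl)
        (by norm_num) (by norm_num) (by norm_num) ⟨v, hv⟩ hex M archPk archSub Ψ act Mmod region frobAdm frobLogvol frobΨ frobMmod
        unitImage ballImage thetaDiv n lat sig split qData qK
    · exact GenuineK.not_pilotKummerCompatHull_chosen_ratPoint_of_star_envelope_of_not_dvd T ⟨23, hp⟩ (by norm_num) (by norm_num)
        10 (by norm_num) hord 5 (by norm_num) 3 1 0 7 (by norm_num) (by norm_num) (by norm_num) (by norm_num) (Or.inl rfl)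
        (by norm_num) (by norm_num) (by norm_num) ⟨v, hv⟩ hex M archPk archSub Ψ act Mmod region frobAdm frobLogvol frobΨ frobMmod
        unitImage ballImage thetaDiv n lat sig split qData qK
    · exact GenuineK.not_pilotKummerCompatHull_chosen_ratPoint_of_star_envelope_of_not_dvd T ⟨23, hp⟩ (by norm_num) (by norm_num)
        10 (by norm_num) hord 5 (by norm_num) 6 1 0 7 (by norm_num) (by norm_num) (by norm_num) (by norm_num) (Or.inl rfl)
        (by norm_num) (by norm_num) (by norm_num) ⟨v, hv⟩ hex M archPk archSub Ψ act Mmod region frobAdm frobLogvol frobΨ frobMmod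
        unitImage ballImage thetaDiv n lat sig split qData qK
    · exact GenuineK.not_pilotKummerCompatHull_chosen_ratPoint_of_star_envelope_of_not_dvd T ⟨23, hp⟩ (by norm_num) (by norm_num)
        10 (by norm_num) hord 5 (by norm_num) 13 1 0 7 (by norm_num) (by norm_num) (by norm_num) (by norm_num) (Or.inl rfl)
        (by norm_num) (by norm_num) (by norm_num) ⟨v, hv⟩ hex M archPk archSub Ψ act Mmod region frobAdm frobLogvol frobΨ frobMmod
        unitImage ballImage thetaDiv n lat sig split qData qK
    · exact GenuineK.not_pilotKummerCompatHull_chosen_ratPoint_of_star_envelope_of_not_dvd T ⟨23, hp⟩ (by norm_num) (by norm_num)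
        10 (by norm_num) hord 5 (by norm_num) 26 2 1 7 (by norm_num) (by norm_num) (by norm_num) (by norm_num) (Or.inr (by norm_num))
        (by norm_num) (by norm_num) (by norm_num) ⟨v, hv⟩ hex M archPk archSub Ψ act Mmod region frobAdm frobLogvol frobΨ frobMmod
        unitImage ballImage thetaDiv n lat sig split qData qK
    · exact GenuineK.not_pilotKummerCompatHull_chosen_ratPoint_of_star_envelope_of_not_dvd T ⟨23, hp⟩ (by norm_num) (by norm_num)
        10 (by norm_num) hord 5 (by norm_num) 39 2 1 7 (by norm_num) (by norm_num) (by norm_num) (by norm_num) (Or.inr (by norm_num))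
        (by norm_num) (by norm_num) (by norm_num) ⟨v, hv⟩ hex M archPk archSub Ψ act Mmod region frobAdm frobLogvol frobΨ frobMmod
        unitImage ballImage thetaDiv n lat sig split qData qK
    · exact GenuineK.not_pilotKummerCompatHull_chosen_ratPoint_of_star_envelope_of_not_dvd T ⟨23, hp⟩ (by norm_num) (by norm_num)
        10 (by norm_num) hord 5 (by norm_num) 78 4 1 7 (by norm_num) (by norm_num) (by norm_num) (by norm_num) (Or.inr (by norm_num))
        (by norm_num) (by norm_num) (by norm_num) ⟨v, hv⟩ hex M archPk archSub Ψ act Mmod region frobAdm frobLogvol frobΨ frobMmod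
        unitImage ballImage thetaDiv n lat sig split qData qK
  exact key _ rfl hdvd

end Summit.ABC.IUTFork.Conditional

end
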